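import Literature.Topology.FourManifolds.SliceRibbon
import Literature.Topology.FourManifolds.DiscTheoremDiffeotopy
import Literature.Topology.FourManifolds.PosDetStraightenable
import Literature.Topology.FourManifolds.InverseFunctionTheorem
import Literature.Topology.FourManifolds.OneHandlebodyMirrorFour
import HarnessLib

/-!
# Flattening a slice disc near its centre

Topic `Literature/Topology/FourManifolds`; a brick of the discharge of the named fact
`Literature.Topology.FourManifolds.Knot.isSmoothlySlice_iff_isConcordant_unknot` of `SliceRibbon.lean`
(Fox–Milnor (1966), §3, Thm. 3; Livingston (2005), §1, §2.1), direction "slice ⇒ concordant to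
the unknot": the normal form needed by `ConcordanceOfFlatSliceDisc.lean`. Proved here, with no
named facts:

* `Literature.Topology.FourManifolds.Knot.IsSmoothlySlice.exists_isSliceDisc_flat`: a smoothly
  slice knot has a slice disc `g` (`Knot.IsSliceDisc K g`) which is **flat near the centre**:
  `g y = flatDisc y = (y₀, y₁, 0, 0)` for `‖y‖ ≤ ρ` (some `0 < ρ ≤ 1/2`).

This is the smooth content of "a non-singular point": a smooth disc is, near an interior point
and up to a diffeomorphism of the ambient ball fixed near the boundary, a linear plane.

## Proof

Three moves, each a diffeomorphism `Φ` of `ℝ⁴` equal to the identity on `‖z‖ ≥ r₁` for some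
`r₁ < 1`; such a `Φ` carries slice discs of `K` to slice discs of `K`
(`Knot.IsSliceDisc.diffeomorph_comp`: it preserves the open unit ball, and is the identity near
`𝕊³`, where the boundary values and the neatness live).

1. **Centre to the origin** (`exists_apply_zero`): homogeneity of the open unit ball by
   compactly supported diffeotopies (the tree's
   `Diffeomorph.exists_isCompactlyDiffeotopicToIdIn_apply_eq`, Milnor's homogeneity lemma /
   Hirsch (1976), Ch. 8 §3, Thm. 3.1 for `k = 0`) moves `g 0` to `0`.
2. **Linearisation at the origin** (`exists_linear`): extend `g` to the local diffeomorphism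
   `G (z) = g (z₀, z₁) + N (z₂, z₃)` of `ℝ⁴`, `N` a linear isomorphism of `ℝ²` onto the orthogonal
   complement of the tangent plane `L = Dg(0)`; with `M = DG(0)` (so `M ∘ flatDisc = L`) the map
   `Ψ = M ∘ G⁻¹` is tangent to the identity at `0` (inverse function theorem,
   `isLocalDiffeomorphAt_of_mfderiv`), hence agrees near `0` with a diffeomorphism `Θ` supported in
   a small ball (the tree's `exists_diffeomorph_eq_of_fderiv_eq_id`, Hirsch Ch. 8 §3); then
   `Θ ∘ g = M ∘ flatDisc` near `0`.
3. **Straightening the linear part** (`exists_flat_of_linear`): `X = M⁻¹`, composed if necessary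
   with the reflection of the last coordinate (the tree's `reflectFourthCLE`, which fixes the
   plane `flatDisc (ℝ²)`) so that
   `det X > 0`, is compactly straightenable (`isStraightenable_of_det_pos`, the connectedness of
   `GL⁺(4)` made explicit, Hirsch Ch. 8 §3); conjugating by a dilation confines the support to
   `‖z‖ < 1/2`, and `X ∘ M ∘ flatDisc = flatDisc`.

## References

* R. H. Fox, J. W. Milnor, Osaka J. Math. 3 (1966) 257–267, §3, Thm. 3 (p. 265). [FoxMilnor1966]
* M. W. Hirsch, *Differential Topology*, GTM 33 (1976), Ch. 8 §3, Thm. 3.1 and its proof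
  (homogeneity; linearisation; `GL⁺` connected). [HirschDT1976]
* J. Milnor, *Topology from the Differentiable Viewpoint* (1965), §4 (Homogeneity Lemma).
  [MilnorTDV1965]

## Design notes

No named facts, no `sorry`, no instances. Local notation `𝔼 n`, `𝕊 n`, `𝔻²` as in
`SliceRibbon.lean`.
-/

open scoped Manifold ContDiff Topology
open Function Set Metric

noncomputable section

namespace Literature.Topology.FourManifolds

/-- Local notation: `𝔼 n` is the model Euclidean space `EuclideanSpace ℝ (Fin n)`. -/
local notation "𝔼 " n:arg => EuclideanSpace ℝ (Fin n)

/-- Local notation: `𝕊 n` is the unit sphere in `EuclideanSpace ℝ (Fin (n + 1))`. -/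
local notation "𝕊 " n:arg => (Metric.sphere (0 : EuclideanSpace ℝ (Fin (n + 1))) 1)

/-- Local notation: `𝔻²` is the closed unit disc in `ℝ²`. -/
local notation "𝔻²" => Metric.closedBall (0 : EuclideanSpace ℝ (Fin 2)) 1

namespace Knot

/-! ### Transport of slice discs by diffeomorphisms fixed near the boundary sphere -/

/-- **A diffeomorphism of `ℝ⁴` which is the identity on `‖z‖ ≥ r₁`, `r₁ < 1`, carries slice
discs of `K` to slice discs of `K`**: it preserves the open unit ball (being a bijection fixing
its exterior shell pointwise) and agrees with the identity near `𝕊³ ⊇ K`. [folklore] -/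
theorem IsSliceDisc.diffeomorph_comp {K : Knot} {g : 𝔼 2 → 𝔼 4} (hg : K.IsSliceDisc g)
    (Φ : 𝔼 4 ≃ₘ⟮𝓘(ℝ, 𝔼 4), 𝓘(ℝ, 𝔼 4)⟯ 𝔼 4) {r₁ : ℝ} (hr₁ : r₁ < 1)
    (hΦ : ∀ z : 𝔼 4, r₁ ≤ ‖z‖ → Φ z = z) : K.IsSliceDisc (Φ ∘ g) := by
  obtain ⟨hgs, hginj, hgimm, hgint, hgneat, hgK⟩ := hg
  have hΦs : ContDiff ℝ ∞ Φ := contMDiff_iff_contDiff.1 Φ.contMDiff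
  have hΦs' : ContDiff ℝ ∞ Φ.symm := contMDiff_iff_contDiff.1 Φ.symm.contMDiff
  -- `Φ` preserves the ball `‖z‖ < r₁`
  have hball : ∀ z : 𝔼 4, ‖z‖ < r₁ → ‖Φ z‖ < r₁ := by
    intro z hz
    by_contra h
    rw [not_lt] at h
    have h2 : Φ z = z := Φ.injective (hΦ _ h)
    rw [h2] at h
    exact (not_le.2 hz) h
  -- the derivative of `Φ` is injective
  have hDΦ : ∀ z, Injective (fderiv ℝ Φ z) := by
    intro z
    have hd : DifferentiableAt ℝ Φ z := hΦs.differentiable (by simp) z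
    have hd' : DifferentiableAt ℝ Φ.symm (Φ z) := hΦs'.differentiable (by simp) _
    have key : (fderiv ℝ Φ.symm (Φ z)).comp (fderiv ℝ Φ z) = ContinuousLinearMap.id ℝ _ := by
      rw [← fderiv_comp z hd' hd]
      have : ((Φ.symm : 𝔼 4 → 𝔼 4) ∘ Φ) = id := funext fun w ↦ Φ.symm_apply_apply w
      rw [this, fderiv_id]
    intro v w h
    have h' := congrArg (fderiv ℝ Φ.symm (Φ z)) h
    rwa [← ContinuousLinearMap.comp_apply, ← ContinuousLinearMap.comp_apply, key] at h'
  refine ⟨hΦs.comp hgs, Φ.injective.comp_injOn hginj, ?_, ?_, ?_, ?_⟩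
  · intro y hy
    rw [fderiv_comp y (hΦs.differentiable (by simp) _) (hgs.differentiable (by simp) _)]
    exact (hDΦ _).comp (hgimm y hy)
  · intro y hy
    have h := hgint y hy
    show ‖Φ (g y)‖ < 1
    rcases lt_or_ge ‖g y‖ r₁ with h1 | h1
    · exact lt_trans (hball _ h1) hr₁
    · rw [hΦ _ h1]; exact h
  · intro x hx
    have hgx : ‖g x‖ = 1 := by
      rw [show g x = _ from hgK ⟨x, by rwa [mem_sphere_zero_iff_norm]⟩, norm_eq_of_mem_sphere]
    have hev : (fun y ↦ ‖(Φ ∘ g) y‖ ^ 2) =ᶠ[𝓝 x] fun y ↦ ‖g y‖ ^ 2 := by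
      have hc : ContinuousAt (fun y ↦ ‖g y‖) x := (hgs.continuous.norm).continuousAt
      have : ∀ᶠ y in 𝓝 x, r₁ < ‖g y‖ :=
        hc.eventually (lt_mem_nhds (show r₁ < ‖g x‖ by rw [hgx]; exact hr₁))
      filter_upwards [this] with y hy
      simp only [comp_apply, hΦ _ hy.le]
    rw [hev.fderiv_eq]
    exact hgneat x hx
  · intro x
    simp only [comp_apply, hgK x]
    exact hΦ _ (by rw [norm_eq_of_mem_sphere]; exact hr₁.le)

namespace Flatten

/-! ### Step 1: the centre to the origin -/

/-- **The centre of a slice disc can be moved to the origin** (homogeneity of the open unit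
ball by compactly supported diffeotopies). [cite: HirschDT1976, Ch. 8 §3, Thm. 3.1 (k = 0)] -/
theorem exists_apply_zero {K : Knot} {g : 𝔼 2 → 𝔼 4} (hg : K.IsSliceDisc g) :
    ∃ g₁ : 𝔼 2 → 𝔼 4, K.IsSliceDisc g₁ ∧ g₁ 0 = 0 := by
  have h0 : g 0 ∈ ball (0 : 𝔼 4) 1 := by
    rw [mem_ball_zero_iff]
    exact hg.2.2.2.1 0 (by simp)
  obtain ⟨P, hP, hP0⟩ := Diffeomorph.exists_isCompactlyDiffeotopicToIdIn_apply_eq (M := 𝔼 4)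
    (n := 4) isOpen_ball (convex_ball (0 : 𝔼 4) 1).isPreconnected h0 (mem_ball_self one_pos)
  obtain ⟨D, C, hC, hCW, hD1, hDC⟩ := hP
  -- a radius `r₁ < 1` beyond which `P` is the identity
  obtain ⟨r₁, hr₁, hCr⟩ : ∃ r₁ : ℝ, r₁ < 1 ∧ ∀ z ∈ C, ‖z‖ < r₁ := by
    rcases C.eq_empty_or_nonempty with hCe | hCne
    · exact ⟨1 / 2, by norm_num, fun z hz ↦ by simp [hCe] at hz⟩
    · obtain ⟨z₀, hz₀C, hz₀⟩ := hC.exists_isMaxOn hCne continuous_norm.continuousOn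
      have h1 : ‖z₀‖ < 1 := mem_ball_zero_iff.1 (hCW hz₀C)
      exact ⟨(‖z₀‖ + 1) / 2, by linarith, fun z hz ↦ by
        have : ‖z‖ ≤ ‖z₀‖ := hz₀ hz; linarith⟩
  refine ⟨P ∘ g, hg.diffeomorph_comp P hr₁ (fun z hz ↦ ?_), by simp [hP0]⟩
  have hzC : z ∉ C := fun h ↦ (not_lt.2 hz) (hCr z h)
  rw [← hD1, Diffeotopy.coe_stage]
  exact hDC 1 z hzC

/-! ### Coordinates: the splitting `ℝ⁴ = flatDisc (ℝ²) ⊕ tailIncl (ℝ²)` -/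

/-- The first two coordinates `(z₀, z₁)` of a point of `ℝ⁴`. [folklore] -/
def headProj : 𝔼 4 →L[ℝ] 𝔼 2 :=
  LinearMap.toContinuousLinearMap
    { toFun := fun z ↦ WithLp.toLp 2 fun i : Fin 2 ↦ z ⟨i, by omega⟩
      map_add' := fun x y ↦ by ext i; simp
      map_smul' := fun c x ↦ by ext i; simp }

/-- The last two coordinates `(z₂, z₃)` of a point of `ℝ⁴`. [folklore] -/
def tailProj : 𝔼 4 →L[ℝ] 𝔼 2 :=
  LinearMap.toContinuousLinearMap
    { toFun := fun z ↦ WithLp.toLp 2 fun i : Fin 2 ↦ z ⟨i + 2, by omega⟩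
      map_add' := fun x y ↦ by ext i; simp
      map_smul' := fun c x ↦ by ext i; simp }

/-- The inclusion `(y₀, y₁) ↦ (0, 0, y₀, y₁)` of `ℝ²` as the last two coordinates of `ℝ⁴`.
[folklore] -/
def tailIncl : 𝔼 2 →L[ℝ] 𝔼 4 :=
  LinearMap.toContinuousLinearMap
    { toFun := fun y ↦ WithLp.toLp 2 fun i : Fin 4 ↦
        if h : 2 ≤ (i : ℕ) then y ⟨i - 2, by omega⟩ else 0
      map_add' := fun x y ↦ by
        ext i
        simp only [PiLp.add_apply]
        split_ifs <;> simp
      map_smul' := fun c x ↦ by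
        ext i
        simp only [PiLp.smul_apply, RingHom.id_apply, smul_eq_mul]
        split_ifs <;> simp }

/-- `headProj (flatDisc y) = y`. [folklore] -/
@[simp]
theorem headProj_flatDisc (y : 𝔼 2) : headProj (flatDisc y) = y := by
  ext i
  fin_cases i <;> simp [headProj, flatDisc_apply]

/-- `tailProj (flatDisc y) = 0`. [folklore] -/
@[simp]
theorem tailProj_flatDisc (y : 𝔼 2) : tailProj (flatDisc y) = 0 := by
  ext i
  simp [tailProj, flatDisc_apply]

/-- `z = flatDisc (headProj z) + tailIncl (tailProj z)`. [folklore] -/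
theorem flatDisc_headProj_add_tailIncl_tailProj (z : 𝔼 4) :
    flatDisc (headProj z) + tailIncl (tailProj z) = z := by
  ext i
  simp only [headProj, tailProj, tailIncl, flatDisc_apply, euclideanInclusion_apply,
    LinearMap.coe_toContinuousLinearMap', LinearMap.coe_mk, AddHom.coe_mk, PiLp.add_apply]
  fin_cases i <;> simp

/-! ### Step 2: linearisation at the origin -/

/-- A linear complement of an injective `L : ℝ² → ℝ⁴`: an injective linear `N : ℝ² → ℝ⁴` (onto
the orthogonal complement of the range of `L`) with `range L ∩ range N = 0`. [folklore] -/
theorem exists_complement {L : 𝔼 2 →L[ℝ] 𝔼 4} (hL : Injective L) :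
    ∃ N : 𝔼 2 →L[ℝ] 𝔼 4, ∀ a b : 𝔼 2, L a + N b = 0 → a = 0 ∧ b = 0 := by
  set V : Submodule ℝ (𝔼 4) := LinearMap.range (L : 𝔼 2 →ₗ[ℝ] 𝔼 4) with hV_def
  have hV : Module.finrank ℝ V = 2 := by
    rw [hV_def, LinearMap.finrank_range_of_inj (f := (L : 𝔼 2 →ₗ[ℝ] 𝔼 4)) hL]
    simp
  have hVo : Module.finrank ℝ (𝔼 2) = Module.finrank ℝ Vᗮ := by
    have := Submodule.finrank_add_finrank_orthogonal V
    rw [hV, finrank_euclideanSpace_fin] at this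
    rw [finrank_euclideanSpace_fin]
    omega
  set N₀ : 𝔼 2 ≃ₗ[ℝ] Vᗮ := LinearEquiv.ofFinrankEq _ _ hVo with hN₀
  set Nlin : 𝔼 2 →ₗ[ℝ] 𝔼 4 := Vᗮ.subtype ∘ₗ (N₀ : 𝔼 2 →ₗ[ℝ] Vᗮ) with hNlin
  refine ⟨LinearMap.toContinuousLinearMap Nlin, fun a b h ↦ ?_⟩
  have ha : L a ∈ V := LinearMap.mem_range_self (L : 𝔼 2 →ₗ[ℝ] 𝔼 4) a
  have hb : Nlin b ∈ Vᗮ := (N₀ b).2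
  have hLa : (L a : 𝔼 4) = -Nlin b := eq_neg_of_add_eq_zero_left h
  have hmem : L a ∈ V ⊓ Vᗮ := ⟨ha, by rw [hLa]; exact Vᗮ.neg_mem hb⟩
  rw [Submodule.inf_orthogonal_eq_bot, Submodule.mem_bot] at hmem
  have ha0 : a = 0 := hL (by rw [hmem, map_zero])
  refine ⟨ha0, ?_⟩
  have hNb : Nlin b = 0 := by
    have : Nlin b = -L a := eq_neg_of_add_eq_zero_right h
    rw [this, hmem, neg_zero]
  have : (N₀ b : 𝔼 4) = 0 := hNb
  have hb0 : N₀ b = 0 := Subtype.ext this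
  simpa using hb0

/-- **Linearisation at the origin**: a slice disc through the origin can be replaced by one which
is *linear* near the centre, `g₂ y = M (flatDisc y)` for `‖y‖ ≤ ρ`, with `M` a linear automorphism
of `ℝ⁴` (inverse function theorem for `G (z) = g (z₀, z₁) + N (z₂, z₃)` and compactly supported
realisation of the map `DG(0) ∘ G⁻¹`, tangent to the identity).
[cite: HirschDT1976, Ch. 8 §3, proof of Thm. 3.1] -/
theorem exists_linear {K : Knot} {g : 𝔼 2 → 𝔼 4} (hg : K.IsSliceDisc g) (hg0 : g 0 = 0) :
    ∃ g₂ : 𝔼 2 → 𝔼 4, K.IsSliceDisc g₂ ∧ ∃ (M : 𝔼 4 ≃L[ℝ] 𝔼 4) (ρ : ℝ), 0 < ρ ∧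
      ∀ y : 𝔼 2, ‖y‖ ≤ ρ → g₂ y = M (flatDisc y) := by
  have hgs : ContDiff ℝ ∞ g := hg.1
  have hgimm := hg.2.2.1
  set L : 𝔼 2 →L[ℝ] 𝔼 4 := fderiv ℝ g 0 with hL_def
  have hL : Injective L := hgimm 0 (mem_closedBall_self zero_le_one)
  obtain ⟨N, hLN⟩ := exists_complement hL
  -- the linear automorphism `M = L ∘ head + N ∘ tail`
  set Mlin : 𝔼 4 →L[ℝ] 𝔼 4 := L.comp headProj + N.comp tailProj with hMlin
  have hMinj : Injective Mlin := by
    intro z z' h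
    have h0 : Mlin (z - z') = 0 := by rw [map_sub, h, sub_self]
    have h1 : L (headProj (z - z')) + N (tailProj (z - z')) = 0 := h0
    obtain ⟨h2, h3⟩ := hLN _ _ h1
    rw [← sub_eq_zero, ← flatDisc_headProj_add_tailIncl_tailProj (z - z'), h2, h3, map_zero,
      map_zero, add_zero]
  set Me : 𝔼 4 ≃ₗ[ℝ] 𝔼 4 :=
    LinearEquiv.ofInjectiveEndo (K := ℝ) (V := 𝔼 4) Mlin.toLinearMap hMinj with hMe
  set M : 𝔼 4 ≃L[ℝ] 𝔼 4 := Me.toContinuousLinearEquiv with hM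
  have hMapply : ∀ z, M z = L (headProj z) + N (tailProj z) := fun z ↦ rfl
  have hMclm : (M : 𝔼 4 →L[ℝ] 𝔼 4) = Mlin := by
    ext z : 1
    exact hMapply z
  have hMflat : ∀ y, M (flatDisc y) = L y := fun y ↦ by
    rw [hMapply, headProj_flatDisc, tailProj_flatDisc, map_zero, add_zero]
  -- the local diffeomorphism `G`
  set G : 𝔼 4 → 𝔼 4 := fun z ↦ g (headProj z) + N (tailProj z) with hG_def
  have hGs : ContDiff ℝ ∞ G :=
    (hgs.comp headProj.contDiff).add (N.contDiff.comp tailProj.contDiff)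
  have hG0 : G 0 = 0 := by simp [hG_def, hg0]
  have hGflat : ∀ y, G (flatDisc y) = g y := fun y ↦ by
    simp only [hG_def, headProj_flatDisc, tailProj_flatDisc, map_zero, add_zero]
  have hDG : HasFDerivAt G (M : 𝔼 4 →L[ℝ] 𝔼 4) 0 := by
    have h1 : HasFDerivAt (fun z : 𝔼 4 ↦ g (headProj z)) (L.comp headProj) 0 := by
      have := (hgs.differentiable (by simp) (headProj 0)).hasFDerivAt.comp (0 : 𝔼 4)
        headProj.hasFDerivAt
      rwa [map_zero] at this
    have h2 : HasFDerivAt (fun z : 𝔼 4 ↦ N (tailProj z)) (N.comp tailProj) 0 :=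
      (N.comp tailProj).hasFDerivAt
    rw [hMclm]
    exact h1.add h2
  have hGloc : IsLocalDiffeomorphAt 𝓘(ℝ, 𝔼 4) 𝓘(ℝ, 𝔼 4) ∞ G 0 :=
    isLocalDiffeomorphAt_of_mfderiv isOpen_univ (mem_univ _) hGs.contMDiff.contMDiffOn
      (by simp) M (by rw [mfderiv_eq_fderiv, hDG.fderiv])
  -- its local inverse `H` and the map `Ψ = M ∘ H`, tangent to the identity at `0`
  set H := hGloc.localInverse with hH
  have h0s : (0 : 𝔼 4) ∈ H.source := by
    have := hGloc.localInverse_mem_source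
    rwa [hG0] at this
  have h0t : (0 : 𝔼 4) ∈ H.target := hGloc.localInverse_mem_target
  have hHs : ContDiffOn ℝ ∞ H H.source := contMDiffOn_iff_contDiffOn.1 hGloc.localInverse_contMDiffOn
  have hH0 : H 0 = 0 := by
    have := hGloc.localInverse_left_inv h0t
    rwa [hG0] at this
  set Ψ : 𝔼 4 → 𝔼 4 := fun w ↦ M (H w) with hΨ
  set V : Set (𝔼 4) := H.source ∩ ball 0 (1 / 2) with hV
  have hVo : IsOpen V := H.open_source.inter isOpen_ball
  have h0V : (0 : 𝔼 4) ∈ V := ⟨h0s, mem_ball_self (by norm_num)⟩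
  have hΨs : ContDiffOn ℝ ∞ Ψ V :=
    (M : 𝔼 4 →L[ℝ] 𝔼 4).contDiff.comp_contDiffOn (hHs.mono inter_subset_left)
  have hΨ0 : Ψ 0 = 0 := by simp [hΨ, hH0]
  have hdH : DifferentiableAt ℝ H 0 :=
    (hHs.contDiffAt (H.open_source.mem_nhds h0s)).differentiableAt (by simp)
  have hDH : fderiv ℝ H 0 = (M.symm : 𝔼 4 →L[ℝ] 𝔼 4) := by
    have key : (fderiv ℝ H 0).comp (M : 𝔼 4 →L[ℝ] 𝔼 4) = ContinuousLinearMap.id ℝ _ := by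
      have h := hGloc.localInverse_eventuallyEq_left.fderiv_eq (𝕜 := ℝ)
      have hdH' : DifferentiableAt ℝ H (G 0) := by rw [hG0]; exact hdH
      rw [fderiv_id, fderiv_comp 0 hdH' hDG.differentiableAt, hDG.fderiv, hG0] at h
      exact h
    have := congrArg (fun T : 𝔼 4 →L[ℝ] 𝔼 4 ↦ T.comp (M.symm : 𝔼 4 →L[ℝ] 𝔼 4)) key
    simp only [ContinuousLinearMap.comp_assoc, ContinuousLinearEquiv.coe_comp_coe_symm,
      ContinuousLinearMap.comp_id, ContinuousLinearMap.id_comp] at this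
    exact this
  have hDΨ : fderiv ℝ Ψ 0 = ContinuousLinearMap.id ℝ _ := by
    have : HasFDerivAt Ψ ((M : 𝔼 4 →L[ℝ] 𝔼 4).comp (fderiv ℝ H 0)) 0 :=
      (M : 𝔼 4 →L[ℝ] 𝔼 4).hasFDerivAt.comp 0 hdH.hasFDerivAt
    rw [this.fderiv, hDH, ContinuousLinearEquiv.coe_comp_coe_symm]
  -- compactly supported realisation of `Ψ`
  obtain ⟨r, hr, hrV, Θ, hΘΨ, hΘid⟩ := exists_diffeomorph_eq_of_fderiv_eq_id hVo h0V hΨs hΨ0 hDΨ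
  have h2r : 2 * r < 1 := by
    have hu : ‖flatDisc ((circlePoint 0 : 𝕊 1) : 𝔼 2)‖ = 1 := by
      rw [norm_flatDisc, norm_eq_of_mem_sphere]
    have hmem : (2 * r) • flatDisc ((circlePoint 0 : 𝕊 1) : 𝔼 2) ∈ closedBall (0 : 𝔼 4) (2 * r) := by
      rw [mem_closedBall_zero_iff, norm_smul, hu, mul_one, Real.norm_of_nonneg (by linarith)]
    have := mem_ball_zero_iff.1 (hrV hmem).2
    rw [norm_smul, hu, mul_one, Real.norm_of_nonneg (by linarith)] at this
    linarith
  -- the new disc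
  refine ⟨Θ ∘ g, hg.diffeomorph_comp Θ h2r hΘid, M, ?_⟩
  -- near `0`, `Θ (g y) = Ψ (g y) = M (H (G (flatDisc y))) = M (flatDisc y)`
  have hev : ∀ᶠ y in 𝓝 (0 : 𝔼 2), g y ∈ closedBall (0 : 𝔼 4) r ∧ flatDisc y ∈ H.target := by
    refine Filter.Eventually.and ?_ ?_
    · have hc : ContinuousAt g 0 := hgs.continuous.continuousAt
      have : closedBall (0 : 𝔼 4) r ∈ 𝓝 (g 0) := by
        rw [hg0]; exact closedBall_mem_nhds _ hr
      exact hc.preimage_mem_nhds this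
    · exact flatDisc.continuous.continuousAt.preimage_mem_nhds
        (by rw [map_zero]; exact H.open_target.mem_nhds h0t)
  obtain ⟨ε, hε, hball⟩ := Metric.eventually_nhds_iff_ball.1 hev
  refine ⟨ε / 2, by positivity, fun y hy ↦ ?_⟩
  have hy' : y ∈ ball (0 : 𝔼 2) ε := by
    rw [mem_ball_zero_iff]; linarith
  obtain ⟨hgy, hfy⟩ := hball y hy'
  calc (Θ ∘ g) y = Ψ (g y) := hΘΨ _ hgy
    _ = M (H (G (flatDisc y))) := by rw [hGflat]
    _ = M (flatDisc y) := by rw [hGloc.localInverse_left_inv hfy]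

/-! ### Step 3: straightening the linear part -/

/-- The reflection in the last coordinate (the tree's `reflectFourthCLE`,
`OneHandlebodyMirrorFour.lean`) fixes the flat plane pointwise. [folklore] -/
theorem reflectFourthCLE_flatDisc (y : 𝔼 2) : reflectFourthCLE (flatDisc y) = flatDisc y := by
  ext i
  rw [reflectFourthCLE_apply_coord]
  split_ifs with h
  · subst h
    simp [flatDisc_apply]
  · rfl

/-- For a linear automorphism `M` of `ℝ⁴`, the automorphism `X = M⁻¹` or `X = R ∘ M⁻¹` (`R` the
reflection in the last coordinate, `reflectFourthCLE`), whichever has positive determinant.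
[folklore] -/
def fixSign (M : 𝔼 4 ≃L[ℝ] 𝔼 4) : 𝔼 4 ≃L[ℝ] 𝔼 4 :=
  if 0 < LinearMap.det ((M.symm : 𝔼 4 →L[ℝ] 𝔼 4) : 𝔼 4 →ₗ[ℝ] 𝔼 4) then M.symm
  else M.symm.trans reflectFourthCLE

/-- `fixSign M` undoes `M` on the flat plane. [folklore] -/
theorem fixSign_apply_flatDisc (M : 𝔼 4 ≃L[ℝ] 𝔼 4) (y : 𝔼 2) :
    fixSign M (M (flatDisc y)) = flatDisc y := by
  unfold fixSign
  split_ifs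
  · exact M.symm_apply_apply _
  · rw [ContinuousLinearEquiv.trans_apply, M.symm_apply_apply, reflectFourthCLE_flatDisc]

/-- `fixSign M` has positive determinant. [folklore] -/
theorem det_fixSign_pos (M : 𝔼 4 ≃L[ℝ] 𝔼 4) :
    0 < LinearMap.det ((fixSign M : 𝔼 4 →L[ℝ] 𝔼 4) : 𝔼 4 →ₗ[ℝ] 𝔼 4) := by
  -- `det M⁻¹ ≠ 0`
  have hne : LinearMap.det ((M.symm : 𝔼 4 →L[ℝ] 𝔼 4) : 𝔼 4 →ₗ[ℝ] 𝔼 4) ≠ 0 := by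
    intro h
    have h1 : ((M.symm : 𝔼 4 →L[ℝ] 𝔼 4) : 𝔼 4 →ₗ[ℝ] 𝔼 4) ∘ₗ
        ((M : 𝔼 4 →L[ℝ] 𝔼 4) : 𝔼 4 →ₗ[ℝ] 𝔼 4) = LinearMap.id := by
      apply LinearMap.ext
      intro z
      simp
    have h2 := congrArg LinearMap.det h1
    rw [LinearMap.det_comp, h, zero_mul, LinearMap.det_id] at h2
    exact zero_ne_one h2
  unfold fixSign
  split_ifs with h
  · exact h
  · have hlt : LinearMap.det ((M.symm : 𝔼 4 →L[ℝ] 𝔼 4) : 𝔼 4 →ₗ[ℝ] 𝔼 4) < 0 :=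
      lt_of_le_of_ne (not_lt.1 h) hne
    have hcomp : (((M.symm.trans reflectFourthCLE : 𝔼 4 ≃L[ℝ] 𝔼 4) : 𝔼 4 →L[ℝ] 𝔼 4) :
        𝔼 4 →ₗ[ℝ] 𝔼 4) = ((reflectFourthCLE : 𝔼 4 →L[ℝ] 𝔼 4) : 𝔼 4 →ₗ[ℝ] 𝔼 4) ∘ₗ
          ((M.symm : 𝔼 4 →L[ℝ] 𝔼 4) : 𝔼 4 →ₗ[ℝ] 𝔼 4) := by
      apply LinearMap.ext
      intro z
      rfl
    rw [hcomp, LinearMap.det_comp, det_reflectFourthCLE]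
    linarith

/-- The dilation `z ↦ c • z` (`c ≠ 0`) as a continuous linear automorphism. [folklore] -/
def dilation (c : ℝ) (hc : c ≠ 0) : 𝔼 4 ≃L[ℝ] 𝔼 4 :=
  ContinuousLinearEquiv.equivOfInverse (c • ContinuousLinearMap.id ℝ (𝔼 4))
    (c⁻¹ • ContinuousLinearMap.id ℝ (𝔼 4))
    (fun y ↦ show c⁻¹ • c • y = y by rw [smul_smul, inv_mul_cancel₀ hc, one_smul])
    (fun y ↦ show c • c⁻¹ • y = y by rw [smul_smul, mul_inv_cancel₀ hc, one_smul])

/-- **Compactly supported realisation of a linear automorphism of positive determinant inside the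
ball of radius `1/2`**: a diffeomorphism of `ℝ⁴` equal to `X` near `0` and to the identity on
`‖z‖ ≥ 1/2` (`isStraightenable_of_det_pos` conjugated by a dilation).
[cite: HirschDT1976, Ch. 8 §3, proof of Thm. 3.1] -/
theorem exists_diffeomorph_eq_linear {X : 𝔼 4 ≃L[ℝ] 𝔼 4}
    (hX : 0 < LinearMap.det ((X : 𝔼 4 →L[ℝ] 𝔼 4) : 𝔼 4 →ₗ[ℝ] 𝔼 4)) :
    ∃ (s : 𝔼 4 ≃ₘ⟮𝓘(ℝ, 𝔼 4), 𝓘(ℝ, 𝔼 4)⟯ 𝔼 4) (l : ℝ), 0 < l ∧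
      (∀ z, ‖z‖ ≤ l → s z = X z) ∧ (∀ z, 1 / 2 ≤ ‖z‖ → s z = z) := by
  obtain ⟨s, R, hs1, hs2⟩ := (isStraightenable_of_det_pos X hX).exists_eq_on_closedBall
  set l : ℝ := 1 / (2 * (|R| + 1)) with hl
  have hl0 : 0 < l := by positivity
  have hl1 : l * |R| ≤ 1 / 2 := by
    rw [hl, div_mul_eq_mul_div, one_mul, div_le_iff₀ (by positivity)]
    nlinarith [abs_nonneg R]
  let D : 𝔼 4 ≃L[ℝ] 𝔼 4 := dilation l hl0.ne'
  let Dinv : 𝔼 4 ≃L[ℝ] 𝔼 4 := dilation l⁻¹ (inv_ne_zero hl0.ne')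
  have hD : ∀ y, D y = l • y := fun y ↦ rfl
  have hDinv : ∀ y, Dinv y = l⁻¹ • y := fun y ↦ rfl
  refine ⟨(Dinv.toDiffeomorph.trans s).trans D.toDiffeomorph, l, hl0, fun z hz ↦ ?_, fun z hz ↦ ?_⟩
  · simp only [Diffeomorph.coe_trans, ContinuousLinearEquiv.coe_toDiffeomorph, comp_apply, hD, hDinv]
    have hn : ‖l⁻¹ • z‖ ≤ 1 := by
      rw [norm_smul, norm_inv, Real.norm_of_nonneg hl0.le, inv_mul_le_iff₀ hl0]
      linarith
    rw [hs1 _ hn, map_smul, smul_smul, mul_inv_cancel₀ hl0.ne', one_smul]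
    rfl
  · simp only [Diffeomorph.coe_trans, ContinuousLinearEquiv.coe_toDiffeomorph, comp_apply, hD, hDinv]
    have hn : R ≤ ‖l⁻¹ • z‖ := by
      rw [norm_smul, norm_inv, Real.norm_of_nonneg hl0.le]
      calc R ≤ |R| := le_abs_self R
        _ ≤ l⁻¹ * (1 / 2) := by
          rw [le_inv_mul_iff₀ hl0]; exact hl1
        _ ≤ l⁻¹ * ‖z‖ := by gcongr
    rw [hs2 _ hn, smul_smul, mul_inv_cancel₀ hl0.ne', one_smul]

/-- **Straightening the linear part**: a slice disc which is linear near the centre,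
`g y = M (flatDisc y)` for `‖y‖ ≤ ρ`, can be replaced by one which is *flat* near the centre,
`g₃ y = flatDisc y` for `‖y‖ ≤ ρ₃`. [cite: HirschDT1976, Ch. 8 §3, proof of Thm. 3.1] -/
theorem exists_flat_of_linear {K : Knot} {g : 𝔼 2 → 𝔼 4} (hg : K.IsSliceDisc g)
    (M : 𝔼 4 ≃L[ℝ] 𝔼 4) {ρ : ℝ} (hρ : 0 < ρ) (hlin : ∀ y : 𝔼 2, ‖y‖ ≤ ρ → g y = M (flatDisc y)) :
    ∃ g₃ : 𝔼 2 → 𝔼 4, K.IsSliceDisc g₃ ∧ ∃ ρ₃ : ℝ, 0 < ρ₃ ∧ ρ₃ ≤ 1 / 2 ∧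
      ∀ y : 𝔼 2, ‖y‖ ≤ ρ₃ → g₃ y = flatDisc y := by
  obtain ⟨s, l, hl, hsX, hsid⟩ := exists_diffeomorph_eq_linear (det_fixSign_pos M)
  refine ⟨s ∘ g, hg.diffeomorph_comp s (by norm_num : (1 : ℝ) / 2 < 1) hsid, ?_⟩
  -- radius: `‖y‖ ≤ ρ₃` forces `‖M (flatDisc y)‖ ≤ l`
  set C : ℝ := ‖(M : 𝔼 4 →L[ℝ] 𝔼 4)‖ + 1 with hC
  have hC0 : 0 < C := by positivity
  refine ⟨min (min ρ (1 / 2)) (l / C), lt_min (lt_min hρ (by norm_num)) (by positivity),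
    (min_le_left _ _).trans (min_le_right _ _), fun y hy ↦ ?_⟩
  have hyρ : ‖y‖ ≤ ρ := hy.trans ((min_le_left _ _).trans (min_le_left _ _))
  have hyl : ‖y‖ ≤ l / C := hy.trans (min_le_right _ _)
  have hn : ‖M (flatDisc y)‖ ≤ l := by
    calc ‖M (flatDisc y)‖ = ‖(M : 𝔼 4 →L[ℝ] 𝔼 4) (flatDisc y)‖ := rfl
      _ ≤ ‖(M : 𝔼 4 →L[ℝ] 𝔼 4)‖ * ‖flatDisc y‖ := ContinuousLinearMap.le_opNorm _ _
      _ ≤ C * ‖y‖ := by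
        rw [norm_flatDisc]
        exact mul_le_mul_of_nonneg_right (by linarith) (norm_nonneg _)
      _ ≤ C * (l / C) := by gcongr
      _ = l := mul_div_cancel₀ _ hC0.ne'
  rw [comp_apply, hlin y hyρ, hsX _ hn]
  exact fixSign_apply_flatDisc M y

end Flatten

/-- **A smoothly slice knot has a slice disc which is flat near the centre** (`g y = flatDisc y`
for `‖y‖ ≤ ρ`, some `0 < ρ ≤ 1/2`): move the centre to the origin, linearise there, and straighten
the linear part, by diffeomorphisms of `ℝ⁴` supported inside the open unit ball
(`Flatten.exists_apply_zero`, `Flatten.exists_linear`, `Flatten.exists_flat_of_linear`). This is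
the non-singularity of an interior point of a smooth disc in the sense of Fox–Milnor (1966), §1,
in the smooth category (Hirsch (1976), Ch. 8 §3, proof of Thm. 3.1).
[cite: HirschDT1976, Ch. 8 §3, proof of Thm. 3.1] -/
theorem IsSmoothlySlice.exists_isSliceDisc_flat {K : Knot} (h : K.IsSmoothlySlice) :
    ∃ (g : 𝔼 2 → 𝔼 4) (ρ : ℝ), K.IsSliceDisc g ∧ 0 < ρ ∧ ρ ≤ 1 / 2 ∧
      ∀ y : 𝔼 2, ‖y‖ ≤ ρ → g y = flatDisc y := by
  obtain ⟨g, hg⟩ := h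
  obtain ⟨g₁, hg₁, hg₁0⟩ := Flatten.exists_apply_zero hg
  obtain ⟨g₂, hg₂, M, ρ, hρ, hlin⟩ := Flatten.exists_linear hg₁ hg₁0
  obtain ⟨g₃, hg₃, ρ₃, hρ₃, hρ₃2, hflat⟩ := Flatten.exists_flat_of_linear hg₂ M hρ hlin
  exact ⟨g₃, ρ₃, hg₃, hρ₃, hρ₃2, hflat⟩

end Knot

end Literature.Topology.FourManifolds
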